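import Summits.HodgeConjecture.CorCM.TwoSheetDegenerateBalanced
import Mathlib.GroupTheory.SpecificGroups.Quaternion
import Mathlib.NumberTheory.GaussSum
import Mathlib.NumberTheory.LegendreSymbol.QuadraticChar.Basic
import Mathlib.Analysis.SpecialFunctions.Complex.Circle
import HarnessLib

/-!
# THE TWO-SHEET NORM FORMAT on `Q_{4m} × C_p` as a THEOREM: a Gauss-alphabet word whose two-sheet norm vanishes in
# `ℤ[η][X]/(X^m + 1)` yields a non-zero antisymmetric annihilated weight, balanced over `C_p`

COR-CM (cell `pub-hodgecm2`), binder seat b04 (gen 41), count-neutral own lane «Galois-CM-type classification» (blanket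
`CorCM/Galois*`).  KERNEL ONLY: theorems; no definition, no named fact, no `sorry`.  `HC_CM` is neither used nor claimed.

SETTING.  `H₀ = Q_{4m} × C_p = QuaternionGroup m × Multiplicative (ZMod p)`, `p ≡ 3 (mod 4)` prime, `c₁ = (aᵐ, 1)`; the abelian
subgroup `A = ⟨a⟩ × C_p ≅ ℤ/2m × ℤ/p` has index two (`x = (xa 0, 1)`, `x (aʲ, v) x⁻¹ = (a⁻ʲ, v)`, `x² = c₁`).  A CM set `T₁ ⊆ H₀` whose
fibres over `aʲ` and `x aʲ` are unions of the three classes `{0}`, `R` (non-zero squares), `N` (non-squares) of `ℤ/p` is a GAUSS WORD: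
bits `z r n : ℤ/2m → Bool` per sheet, letters `val_j = z_j + r_j η + n_j η' = (z_j − n_j) + (r_j − n_j) η` with `η = Σ_R ξ^v`,
`η' = Σ_N ξ^v = −1 − η`, `η² + η + (p+1)/4 = 0` (GAUSS).  At the odd character `χ₀ = (ζ_{2m}ʲ ξᵛ)` of `A` the two-sheet block of `T₁` is
`Ŝ₁Ŝ₁^θ + Ŝ₂Ŝ₂^θ = Σ_{d ∈ ℤ/2m} ζᵈ E_d`, `E_d = Σ_j (val_{j+d} val_j + val′_{j+d} val′_j) ∈ ℤ[η]`; so the INTEGER identities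
`E_d = 0` (`d ∈ ℤ/2m`; `O(m²)` products — a `decide`) make the block singular, and the two-sheet degeneracy lemma with balance
(`CorCM/TwoSheetDegenerateBalanced`, `N = C_p`: `Σ_v ξ^v = 0`) gives a non-zero `c₁`-antisymmetric rational weight annihilated by the right
translates of `T₁` and BALANCED OVER `C_p` — the input of the weight lift `CorCM/GaloisWeightCertificateLift` (the Galois dress is
`CorCM/GaloisQuaternionCyclicTwoSheetNormLift`).  This replaces gen 40's brute-force balanced-set check (`|H₀|·#D` memberships) by an
`O(m²)` certificate, and is the kernel form of the REFLECTION ANSATZ of gen 41 (A7-JUNCTION).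

* §1 `gaussPeriod_sq` — `η² + η + (p+1)/4 = 0` for `η = Σ_{v ∈ R} ξ^v`, `p ≡ 3 (mod 4)` (Mathlib's `gaussSum_sq`).
* §2 **`exists_balanced_annihilator_of_twoSheet_word`** — the model theorem.

## References

* [Kubota1965] T. Kubota, Trans. AMS 118 (1965), §4 Lemma 2.  [Dodson1984] B. Dodson, Trans. AMS 283 (1984), §5.3.
* [Gordon1999HodgeAVSurvey] B. B. Gordon, *A survey of the Hodge conjecture for abelian varieties*, Prop. 9.4.1, §9.4.
-/

noncomputable section

open scoped BigOperators

namespace Summit.HodgeConjecture.CorCM.GaloisQuaternionCyclic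

open QuaternionGroup AddChar

/-! ## §1 The quadratic Gauss period for `p ≡ 3 (mod 4)` -/

/-- **GAUSS.**  `p ≡ 3 (mod 4)` prime, `ψ` the additive character `v ↦ ξᵛ` of `ℤ/p` for a primitive `p`-th root of unity `ξ ∈ ℂ`,
`η = Σ_{v ≠ 0 square} ψ(v)`: then `η² + η + (p+1)/4 = 0` (from `g² = χ(−1)·p = −p` for the quadratic Gauss sum `g = 2η + 1`).
[cite: Gordon1999HodgeAVSurvey, §9.4] -/
theorem gaussPeriod_sq {p : ℕ} [hp : Fact p.Prime] (hp3 : p % 4 = 3) {ξ : ℂ} (hξ : IsPrimitiveRoot ξ p) :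
    (∑ v ∈ Finset.univ.filter (fun v : ZMod p => v ≠ 0 ∧ IsSquare v), zmodChar p hξ.pow_eq_one v) ^ 2 +
      (∑ v ∈ Finset.univ.filter (fun v : ZMod p => v ≠ 0 ∧ IsSquare v), zmodChar p hξ.pow_eq_one v) +
      ((p : ℂ) + 1) / 4 = 0 := by
  classical
  have hp2 : p ≠ 2 := by rintro rfl; norm_num at hp3
  have hchar : ringChar (ZMod p) ≠ 2 := by rwa [ZMod.ringChar_zmod_n]
  set ψ : AddChar (ZMod p) ℂ := zmodChar p hξ.pow_eq_one with hψ_def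
  have hψprim : ψ.IsPrimitive := zmodChar_primitive_of_primitive_root p hξ
  set χ : MulChar (ZMod p) ℂ := (quadraticChar (ZMod p)).ringHomComp (Int.castRingHom ℂ) with hχ_def
  have hχ1 : χ ≠ 1 := (MulChar.ringHomComp_ne_one_iff Int.cast_injective).mpr (quadraticChar_ne_one hchar)
  have hχ2 : χ.IsQuadratic := (quadraticChar_isQuadratic (ZMod p)).comp _
  have hg := gaussSum_sq hχ1 hχ2 hψprim
  -- `χ(-1) = -1` since `p ≡ 3 (mod 4)`
  have hneg : χ (-1) = -1 := by
    have h : quadraticChar (ZMod p) (-1) = -1 := by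
      rw [quadraticChar_neg_one_iff_not_isSquare, FiniteField.isSquare_neg_one_iff, ZMod.card]
      exact fun h => h hp3
    change ((quadraticChar (ZMod p) (-1) : ℤ) : ℂ) = -1
    rw [h]; norm_num
  rw [hneg, ZMod.card] at hg
  -- `g = Σ_{a} χ(a) ψ(a) = η − η'`, `1 + η + η' = 0`
  set R := Finset.univ.filter (fun v : ZMod p => v ≠ 0 ∧ IsSquare v) with hR
  set Nn := Finset.univ.filter (fun v : ZMod p => ¬ IsSquare v) with hNn
  have hsplit : ∀ f : ZMod p → ℂ, ∑ v, f v = f 0 + ∑ v ∈ R, f v + ∑ v ∈ Nn, f v := fun f => by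
    rw [← Finset.sum_filter_add_sum_filter_not Finset.univ (fun v : ZMod p => IsSquare v)]
    have h1 : Finset.univ.filter (fun v : ZMod p => IsSquare v) = insert 0 R := by
      ext v
      simp only [hR, Finset.mem_filter, Finset.mem_univ, true_and, Finset.mem_insert]
      constructor
      · intro hv; by_cases h0 : v = 0; exact Or.inl h0; exact Or.inr ⟨h0, hv⟩
      · rintro (rfl | ⟨-, hv⟩); exact ⟨0, (mul_zero 0).symm⟩; exact hv
    have h0R : (0 : ZMod p) ∉ R := by simp [hR]
    rw [h1, Finset.sum_insert h0R, add_assoc]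
  have hgsum : gaussSum χ ψ = ∑ v ∈ R, ψ v - ∑ v ∈ Nn, ψ v := by
    rw [gaussSum, hsplit, MulChar.map_zero, zero_mul, zero_add, sub_eq_add_neg, ← Finset.sum_neg_distrib]
    congr 1
    · refine Finset.sum_congr rfl fun v hv => ?_
      obtain ⟨hv0, hvs⟩ := (Finset.mem_filter.mp hv).2
      have : quadraticChar (ZMod p) v = 1 := (quadraticChar_one_iff_isSquare hv0).mpr hvs
      change ((quadraticChar (ZMod p) v : ℤ) : ℂ) * ψ v = ψ v
      rw [this]; norm_num
    · refine Finset.sum_congr rfl fun v hv => ?_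
      have hvs := (Finset.mem_filter.mp hv).2
      have : quadraticChar (ZMod p) v = -1 := quadraticChar_neg_one_iff_not_isSquare.mpr hvs
      change ((quadraticChar (ZMod p) v : ℤ) : ℂ) * ψ v = -ψ v
      rw [this]; norm_num
  have hψ1 : ψ ≠ 1 := by
    intro h
    have h1 : ψ 1 = 1 := by rw [h, AddChar.one_apply]
    rw [hψ_def, zmodChar_apply, ZMod.val_one, pow_one] at h1
    exact hξ.ne_one hp.out.one_lt h1
  have htot : (1 : ℂ) + ∑ v ∈ R, ψ v + ∑ v ∈ Nn, ψ v = 0 := by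
    have h := AddChar.sum_eq_zero_of_ne_one hψ1
    rwa [hsplit, map_zero_eq_one] at h
  have hNn' : ∑ v ∈ Nn, ψ v = -1 - ∑ v ∈ R, ψ v := by linear_combination htot
  rw [hgsum, hNn'] at hg
  linear_combination hg / 4

/-- Splitting a sum over `ℤ/p` into `v = 0`, the non-zero squares and the non-squares. [folklore] -/
theorem sum_eq_zero_add_sq_add_nonsq {p : ℕ} [Fact p.Prime] {M : Type*} [AddCommMonoid M] (f : ZMod p → M) :
    ∑ v, f v = f 0 + ∑ v ∈ Finset.univ.filter (fun v : ZMod p => v ≠ 0 ∧ IsSquare v), f v +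
      ∑ v ∈ Finset.univ.filter (fun v : ZMod p => ¬ IsSquare v), f v := by
  classical
  rw [← Finset.sum_filter_add_sum_filter_not Finset.univ (fun v : ZMod p => IsSquare v)]
  have h1 : Finset.univ.filter (fun v : ZMod p => IsSquare v) =
      insert 0 (Finset.univ.filter (fun v : ZMod p => v ≠ 0 ∧ IsSquare v)) := by
    ext v
    simp only [Finset.mem_filter, Finset.mem_univ, true_and, Finset.mem_insert]
    constructor
    · intro hv; by_cases h0 : v = 0; exact Or.inl h0; exact Or.inr ⟨h0, hv⟩
    · rintro (rfl | ⟨-, hv⟩); exact ⟨0, (mul_zero 0).symm⟩; exact hv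
  have h0R : (0 : ZMod p) ∉ Finset.univ.filter (fun v : ZMod p => v ≠ 0 ∧ IsSquare v) := by simp
  rw [h1, Finset.sum_insert h0R, add_assoc]

/-! ## §2 The model theorem -/

/-- **THE TWO-SHEET NORM FORMAT (model theorem).**  `H₀ = Q_{4m} × C_p` (`p ≡ 3 (mod 4)` prime), `T₁ ⊆ H₀` a GAUSS WORD: its
fibres over `aʲ` resp. `x aʲ` are the unions of `{0}`, `R`, `N ⊆ ℤ/p` selected by the bits `(zu, ru, nu)(j)` resp. `(zv, rv, nv)(j)`,
`j ∈ ℤ/2m`; letters `α = z − n`, `β = r − n` (integers).  If the two-sheet norm vanishes — for every `d ∈ ℤ/2m`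
`Σ_j (α_{j+d}α_j − q β_{j+d}β_j) = 0` and `Σ_j (α_{j+d}β_j + α_jβ_{j+d} − β_{j+d}β_j) = 0`, summed over both sheets, `q = (p+1)/4` —
then there is a non-zero `(aᵐ, 1)`-antisymmetric `b₁ : H₀ → ℚ` annihilated by all right translates of `T₁` and BALANCED OVER `C_p`
(`Σ_v b₁(g·(1, v)) = 0`).  (The CM property of `T₁` is not needed here; it enters in the Galois dress.)
[cite: Kubota1965, §4 Lemma 2] [cite: Dodson1984, §5.3] [cite: Gordon1999HodgeAVSurvey, Prop. 9.4.1] -/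
theorem exists_balanced_annihilator_of_twoSheet_word {m p : ℕ} [NeZero m] [hp : Fact p.Prime] (hp3 : p % 4 = 3)
    (zu ru nu zv rv nv : ZMod (2 * m) → Bool) (T₁ : Finset (QuaternionGroup m × Multiplicative (ZMod p)))
    (hTa : ∀ (j : ZMod (2 * m)) (v : ZMod p), ((a j, Multiplicative.ofAdd v) : QuaternionGroup m × Multiplicative (ZMod p)) ∈ T₁ ↔
      (if v = 0 then zu j else if IsSquare v then ru j else nu j) = true)
    (hTx : ∀ (j : ZMod (2 * m)) (v : ZMod p), ((xa j, Multiplicative.ofAdd v) : QuaternionGroup m × Multiplicative (ZMod p)) ∈ T₁ ↔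
      (if v = 0 then zv j else if IsSquare v then rv j else nv j) = true)
    (hE₁ : ∀ d : ZMod (2 * m), ∑ j : ZMod (2 * m),
      ((((zu (j + d)).toNat : ℤ) - (nu (j + d)).toNat) * (((zu j).toNat : ℤ) - (nu j).toNat) -
          ((p + 1) / 4 : ℕ) * ((((ru (j + d)).toNat : ℤ) - (nu (j + d)).toNat) * (((ru j).toNat : ℤ) - (nu j).toNat)) +
        ((((zv (j + d)).toNat : ℤ) - (nv (j + d)).toNat) * (((zv j).toNat : ℤ) - (nv j).toNat) -
          ((p + 1) / 4 : ℕ) * ((((rv (j + d)).toNat : ℤ) - (nv (j + d)).toNat) * (((rv j).toNat : ℤ) - (nv j).toNat)))) = 0)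
    (hE₂ : ∀ d : ZMod (2 * m), ∑ j : ZMod (2 * m),
      ((((zu (j + d)).toNat : ℤ) - (nu (j + d)).toNat) * (((ru j).toNat : ℤ) - (nu j).toNat) +
          (((zu j).toNat : ℤ) - (nu j).toNat) * (((ru (j + d)).toNat : ℤ) - (nu (j + d)).toNat) -
          (((ru (j + d)).toNat : ℤ) - (nu (j + d)).toNat) * (((ru j).toNat : ℤ) - (nu j).toNat) +
        ((((zv (j + d)).toNat : ℤ) - (nv (j + d)).toNat) * (((rv j).toNat : ℤ) - (nv j).toNat) +
          (((zv j).toNat : ℤ) - (nv j).toNat) * (((rv (j + d)).toNat : ℤ) - (nv (j + d)).toNat) -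
          (((rv (j + d)).toNat : ℤ) - (nv (j + d)).toNat) * (((rv j).toNat : ℤ) - (nv j).toNat))) = 0) :
    ∃ b₁ : QuaternionGroup m × Multiplicative (ZMod p) → ℚ, (∃ y, b₁ y ≠ 0) ∧
      (∀ g, b₁ (((a m, 1) : QuaternionGroup m × Multiplicative (ZMod p)) * g) = -b₁ g) ∧
      (∀ g, ∑ s ∈ T₁, b₁ (s * g) = 0) ∧
      ∀ g, ∑ v : ZMod p, b₁ (g * (1, Multiplicative.ofAdd v)) = 0 := by
  classical
  have hpr : p.Prime := hp.out
  haveI : NeZero p := ⟨hpr.ne_zero⟩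
  have hm0 : m ≠ 0 := NeZero.ne m
  -- (a) the two-sheet structure of `Q_{4m} × C_p`: `A = ⟨a⟩ × C_p ≅ ℤ/2m × ℤ/p`, `x = (xa 0, 1)`
  let i₁ : Multiplicative (ZMod (2 * m)) →* QuaternionGroup m :=
    MonoidHom.mk' (fun u => a (Multiplicative.toAdd u)) fun u v => by simp [toAdd_mul]
  let i : Multiplicative (ZMod (2 * m)) × Multiplicative (ZMod p) →* QuaternionGroup m × Multiplicative (ZMod p) :=
    MonoidHom.prodMap i₁ (MonoidHom.id _)
  have hi_apply : ∀ u v, i (u, v) = (a (Multiplicative.toAdd u), v) := fun u v => rfl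
  have hi : Function.Injective i := by
    rintro ⟨u, v⟩ ⟨u', v'⟩ h
    simp only [hi_apply, Prod.mk.injEq, a.injEq] at h
    exact Prod.ext (by simpa using h.1) h.2
  have hx : ∀ w, i w ≠ (xa 0, 1) := fun ⟨u, v⟩ => by simp [hi_apply]
  have hcov : ∀ g : QuaternionGroup m × Multiplicative (ZMod p), (∃ w, g = i w) ∨ (∃ w, g = i w * (xa 0, 1)) := by
    rintro ⟨j | j, v⟩
    · exact Or.inl ⟨(Multiplicative.ofAdd j, v), by simp [hi_apply]⟩
    · exact Or.inr ⟨(Multiplicative.ofAdd (-j), v), by simp [hi_apply]⟩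
  let θ : Multiplicative (ZMod (2 * m)) × Multiplicative (ZMod p) ≃*
      Multiplicative (ZMod (2 * m)) × Multiplicative (ZMod p) :=
    MulEquiv.prodCongr (MulEquiv.inv _) (MulEquiv.refl _)
  have hθ_apply : ∀ w, θ w = (w.1⁻¹, w.2) := fun w => rfl
  have hθ : ∀ w, ((xa 0, 1) : QuaternionGroup m × Multiplicative (ZMod p)) * i w = i (θ w) * (xa 0, 1) :=
    fun ⟨u, v⟩ => by simp [hi_apply, hθ_apply]
  set c : Multiplicative (ZMod (2 * m)) × Multiplicative (ZMod p) := (Multiplicative.ofAdd (m : ZMod (2 * m)), 1) with hc_def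
  have hic : i c = (a m, 1) := rfl
  have h2m : (m : ZMod (2 * m)) + m = 0 := by
    rw [← Nat.cast_add, show m + m = 2 * m by ring, ZMod.natCast_self]
  have hxx : ((xa 0, 1) : QuaternionGroup m × Multiplicative (ZMod p)) * (xa 0, 1) = i c := by
    rw [hic, Prod.mk_mul_mk, xa_mul_xa, mul_one]
    norm_num
  have hθc : θ c = c := by
    rw [hθ_apply, hc_def]
    refine Prod.ext ?_ rfl
    change Multiplicative.ofAdd (-(m : ZMod (2 * m))) = Multiplicative.ofAdd (m : ZMod (2 * m))
    rw [neg_eq_of_add_eq_zero_left h2m]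
  -- the two sheets of `T₁`
  set S₁ : Finset (Multiplicative (ZMod (2 * m)) × Multiplicative (ZMod p)) :=
    Finset.univ.filter fun w => i w ∈ T₁ with hS₁_def
  set S₂ : Finset (Multiplicative (ZMod (2 * m)) × Multiplicative (ZMod p)) :=
    Finset.univ.filter fun w => i w * (xa 0, 1) ∈ T₁ with hS₂_def
  have hS₁ : ∀ w, w ∈ S₁ ↔ i w ∈ T₁ := fun w => by simp [hS₁_def]
  have hS₂ : ∀ w, w ∈ S₂ ↔ i w * (xa 0, 1) ∈ T₁ := fun w => by simp [hS₂_def]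
  -- (b) the odd character `χ₀(j, v) = ζʲ ξᵛ`, `ζ` a primitive `2m`-th and `ξ` a primitive `p`-th root of unity
  have hζ : IsPrimitiveRoot (Complex.exp (2 * Real.pi * Complex.I / (2 * m : ℕ))) (2 * m) :=
    Complex.isPrimitiveRoot_exp (2 * m) (by positivity)
  have hξ : IsPrimitiveRoot (Complex.exp (2 * Real.pi * Complex.I / p)) p := Complex.isPrimitiveRoot_exp p hpr.ne_zero
  set ψ₂ : AddChar (ZMod (2 * m)) ℂ := zmodChar (2 * m) hζ.pow_eq_one with hψ₂_def
  set ψp : AddChar (ZMod p) ℂ := zmodChar p hξ.pow_eq_one with hψp_def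
  have hψp1 : ψp ≠ 1 := by
    intro h
    have h1 : ψp 1 = 1 := by rw [h, AddChar.one_apply]
    rw [hψp_def, zmodChar_apply, ZMod.val_one, pow_one] at h1
    exact hξ.ne_one hpr.one_lt h1
  have hsumψ : ∑ v : ZMod p, ψp v = 0 := AddChar.sum_eq_zero_of_ne_one hψp1
  have hψ₂m : ψ₂ (m : ZMod (2 * m)) = -1 := by
    have hval : ((m : ℕ) : ZMod (2 * m)).val = m := by
      rw [ZMod.val_natCast]; exact Nat.mod_eq_of_lt (by omega)
    rw [hψ₂_def, zmodChar_apply, hval]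
    have hne : Complex.exp (2 * Real.pi * Complex.I / (2 * m : ℕ)) ^ m ≠ 1 :=
      hζ.pow_ne_one_of_pos_of_lt (by omega) (by omega)
    have hsq : Complex.exp (2 * Real.pi * Complex.I / (2 * m : ℕ)) ^ m * Complex.exp (2 * Real.pi * Complex.I / (2 * m : ℕ)) ^ m = 1 := by
      rw [← pow_add, show m + m = 2 * m by ring, hζ.pow_eq_one]
    rcases mul_self_eq_one_iff.mp hsq with h | h
    · exact absurd h hne
    · exact h
  let χ₀ : AddChar (Additive (Multiplicative (ZMod (2 * m)) × Multiplicative (ZMod p))) ℂ :=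
    { toFun := fun w => ψ₂ (Multiplicative.toAdd (Additive.toMul w).1) * ψp (Multiplicative.toAdd (Additive.toMul w).2)
      map_zero_eq_one' := by simp
      map_add_eq_mul' := fun w w' => by
        simp only [toMul_add, Prod.fst_mul, Prod.snd_mul, toAdd_mul, map_add_eq_mul]; ring }
  have hχ₀ : ∀ (t : Multiplicative (ZMod (2 * m))) (y : Multiplicative (ZMod p)),
      χ₀ (Additive.ofMul (t, y)) = ψ₂ (Multiplicative.toAdd t) * ψp (Multiplicative.toAdd y) := fun t y => rfl
  have hχc : χ₀ (Additive.ofMul c) = -1 := by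
    rw [hc_def, hχ₀, toAdd_ofAdd, toAdd_one, hψ₂m, map_zero_eq_one, mul_one]
  -- the subgroup `C_p ⊆ A` as a finset, on which `χ₀` sums to zero
  let emb : ZMod p ↪ Multiplicative (ZMod (2 * m)) × Multiplicative (ZMod p) :=
    ⟨fun v => (1, Multiplicative.ofAdd v), fun v w h => by simpa using congrArg Prod.snd h⟩
  set N : Finset (Multiplicative (ZMod (2 * m)) × Multiplicative (ZMod p)) := Finset.univ.map emb with hN_def
  have hNsum : ∀ f : Multiplicative (ZMod (2 * m)) × Multiplicative (ZMod p) → ℂ,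
      ∑ n ∈ N, f n = ∑ v : ZMod p, f (1, Multiplicative.ofAdd v) := fun f => by rw [hN_def, Finset.sum_map]; rfl
  have hNsumQ : ∀ f : Multiplicative (ZMod (2 * m)) × Multiplicative (ZMod p) → ℚ,
      ∑ n ∈ N, f n = ∑ v : ZMod p, f (1, Multiplicative.ofAdd v) := fun f => by rw [hN_def, Finset.sum_map]; rfl
  have hN : ∑ n ∈ N, χ₀ (Additive.ofMul n) = 0 := by
    rw [hNsum]
    simp only [hχ₀, toAdd_one, toAdd_ofAdd, map_zero_eq_one, one_mul]
    exact hsumψ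
  -- (c) the Gauss periods and the letters
  set R := Finset.univ.filter (fun v : ZMod p => v ≠ 0 ∧ IsSquare v) with hR_def
  set Nn := Finset.univ.filter (fun v : ZMod p => ¬ IsSquare v) with hNn_def
  set η : ℂ := ∑ v ∈ R, ψp v with hη_def
  set η' : ℂ := ∑ v ∈ Nn, ψp v with hη'_def
  have hη' : η' = -1 - η := by
    have h := hsumψ
    rw [sum_eq_zero_add_sq_add_nonsq, map_zero_eq_one] at h
    linear_combination h
  have hq4 : 4 ∣ p + 1 := by omega
  have hqC : (((p + 1) / 4 : ℕ) : ℂ) = ((p : ℂ) + 1) / 4 := by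
    rw [eq_div_iff (by norm_num : (4 : ℂ) ≠ 0)]
    exact_mod_cast Nat.div_mul_cancel hq4
  have hη2 : η ^ 2 = -η - (((p + 1) / 4 : ℕ) : ℂ) := by
    rw [hqC]; linear_combination gaussPeriod_sq hp3 hξ
  -- the letter value of a fibre: `Σ_v [v ∈ J] ξᵛ = z + r η + n η' = (z − n) + (r − n) η`
  have hletter : ∀ z r n : Bool, ∑ v : ZMod p, (if (if v = 0 then z else if IsSquare v then r else n) = true then ψp v else 0) =
      ((z.toNat : ℤ) - n.toNat : ℤ) + ((r.toNat : ℤ) - n.toNat : ℤ) * η := by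
    intro z r n
    rw [sum_eq_zero_add_sq_add_nonsq]
    have hRsum : ∑ v ∈ R, (if (if v = 0 then z else if IsSquare v then r else n) = true then ψp v else 0) =
        if r = true then η else 0 := by
      rw [hη_def]
      split_ifs with hr
      · refine Finset.sum_congr rfl fun v hv => ?_
        obtain ⟨hv0, hvs⟩ := (Finset.mem_filter.mp hv).2
        simp [hv0, hvs, hr]
      · refine Finset.sum_eq_zero fun v hv => ?_
        obtain ⟨hv0, hvs⟩ := (Finset.mem_filter.mp hv).2
        simp [hv0, hvs, hr]
    have hNsum' : ∑ v ∈ Nn, (if (if v = 0 then z else if IsSquare v then r else n) = true then ψp v else 0) =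
        if n = true then η' else 0 := by
      rw [hη'_def]
      split_ifs with hn
      · refine Finset.sum_congr rfl fun v hv => ?_
        have hvs := (Finset.mem_filter.mp hv).2
        have hv0 : v ≠ 0 := fun h => hvs (h ▸ ⟨0, (mul_zero 0).symm⟩)
        simp [hv0, hvs, hn]
      · refine Finset.sum_eq_zero fun v hv => ?_
        have hvs := (Finset.mem_filter.mp hv).2
        have hv0 : v ≠ 0 := fun h => hvs (h ▸ ⟨0, (mul_zero 0).symm⟩)
        simp [hv0, hvs, hn]
    rw [hRsum, hNsum', hη', map_zero_eq_one]
    cases z <;> cases r <;> cases n <;> simp <;> ring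
  -- letters as integers and complex sheet values
  set αu : ZMod (2 * m) → ℤ := fun j => ((zu j).toNat : ℤ) - (nu j).toNat with hαu
  set βu : ZMod (2 * m) → ℤ := fun j => ((ru j).toNat : ℤ) - (nu j).toNat with hβu
  set αv : ZMod (2 * m) → ℤ := fun j => ((zv j).toNat : ℤ) - (nv j).toNat with hαv
  set βv : ZMod (2 * m) → ℤ := fun j => ((rv j).toNat : ℤ) - (nv j).toNat with hβv
  set Lu : ZMod (2 * m) → ℂ := fun j => (αu j : ℂ) + (βu j : ℂ) * η with hLu
  set Lv : ZMod (2 * m) → ℂ := fun j => (αv j : ℂ) + (βv j : ℂ) * η with hLv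
  have hLu_eq : ∀ j, ∑ v : ZMod p, (if ((a j, Multiplicative.ofAdd v) : QuaternionGroup m × Multiplicative (ZMod p)) ∈ T₁
      then ψp v else 0) = Lu j := fun j => by
    rw [hLu]; simp only [hαu, hβu]
    rw [← hletter (zu j) (ru j) (nu j)]
    exact Finset.sum_congr rfl fun v _ => ite_congr (propext (hTa j v)) (fun _ => rfl) (fun _ => rfl)
  have hLv_eq : ∀ j, ∑ v : ZMod p, (if ((xa j, Multiplicative.ofAdd v) : QuaternionGroup m × Multiplicative (ZMod p)) ∈ T₁
      then ψp v else 0) = Lv j := fun j => by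
    rw [hLv]; simp only [hαv, hβv]
    rw [← hletter (zv j) (rv j) (nv j)]
    exact Finset.sum_congr rfl fun v _ => ite_congr (propext (hTx j v)) (fun _ => rfl) (fun _ => rfl)
  -- (d) the four sheet sums
  have hsumA : ∀ f : Multiplicative (ZMod (2 * m)) × Multiplicative (ZMod p) → ℂ,
      ∑ w, f w = ∑ j : ZMod (2 * m), ∑ v : ZMod p, f (Multiplicative.ofAdd j, Multiplicative.ofAdd v) := fun f => by
    rw [Fintype.sum_prod_type]
    exact Fintype.sum_equiv Multiplicative.toAdd _ _ fun t => Fintype.sum_equiv Multiplicative.toAdd _ _ fun y => by simp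
  have eS₁ : ∑ s ∈ S₁, χ₀ (Additive.ofMul s) = ∑ j : ZMod (2 * m), ψ₂ j * Lu j := by
    rw [hS₁_def, Finset.sum_filter, hsumA]
    refine Finset.sum_congr rfl fun j _ => ?_
    rw [← hLu_eq j, Finset.mul_sum]
    refine Finset.sum_congr rfl fun v _ => ?_
    simp only [hi_apply, toAdd_ofAdd, hχ₀]
    split_ifs <;> simp
  have eS₁θ : ∑ s ∈ S₁, χ₀ (Additive.ofMul (θ s)) = ∑ j : ZMod (2 * m), ψ₂ (-j) * Lu j := by
    rw [hS₁_def, Finset.sum_filter, hsumA]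
    refine Finset.sum_congr rfl fun j _ => ?_
    rw [← hLu_eq j, Finset.mul_sum]
    refine Finset.sum_congr rfl fun v _ => ?_
    simp only [hi_apply, toAdd_ofAdd, hθ_apply, hχ₀, toAdd_inv]
    split_ifs <;> simp
  have hxmem : ∀ (j : ZMod (2 * m)) (y : Multiplicative (ZMod p)),
      ((a j, y) : QuaternionGroup m × Multiplicative (ZMod p)) * (xa 0, 1) = (xa (-j), y) := fun j y => by
    rw [Prod.mk_mul_mk, a_mul_xa, zero_sub, mul_one]
  have eS₂ : ∑ t ∈ S₂, χ₀ (Additive.ofMul t) = ∑ j : ZMod (2 * m), ψ₂ (-j) * Lv j := by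
    rw [hS₂_def, Finset.sum_filter, hsumA]
    refine Fintype.sum_equiv (Equiv.neg _) _ _ fun j => ?_
    rw [Equiv.neg_apply, neg_neg, ← hLv_eq (-j), Finset.mul_sum]
    refine Finset.sum_congr rfl fun v _ => ?_
    simp only [hi_apply, toAdd_ofAdd, hxmem, hχ₀]
    split_ifs <;> simp
  have eS₂θ : ∑ t ∈ S₂, χ₀ (Additive.ofMul (θ t)) = ∑ j : ZMod (2 * m), ψ₂ j * Lv j := by
    rw [hS₂_def, Finset.sum_filter, hsumA]
    refine Fintype.sum_equiv (Equiv.neg _) _ _ fun j => ?_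
    rw [Equiv.neg_apply, ← hLv_eq (-j), Finset.mul_sum]
    refine Finset.sum_congr rfl fun v _ => ?_
    simp only [hi_apply, toAdd_ofAdd, hxmem, hθ_apply, hχ₀, toAdd_inv]
    split_ifs <;> simp
  -- (e) products of sheet sums as character sums of autocorrelations
  have hprod : ∀ L : ZMod (2 * m) → ℂ, (∑ j : ZMod (2 * m), ψ₂ j * L j) * (∑ k : ZMod (2 * m), ψ₂ (-k) * L k) =
      ∑ d : ZMod (2 * m), ψ₂ d * ∑ k : ZMod (2 * m), L (k + d) * L k := fun L => by
    rw [Finset.sum_mul_sum, Finset.sum_comm]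
    have e1 : ∀ k : ZMod (2 * m), ∑ j : ZMod (2 * m), ψ₂ j * L j * (ψ₂ (-k) * L k) =
        ∑ d : ZMod (2 * m), ψ₂ d * (L (k + d) * L k) := fun k => by
      symm
      refine Fintype.sum_equiv (Equiv.addLeft k) _ _ fun d => ?_
      simp only [Equiv.coe_addLeft]
      have : ψ₂ (k + d) * ψ₂ (-k) = ψ₂ d := by rw [← map_add_eq_mul]; congr 1; ring
      rw [← this]; ring
    simp_rw [e1]
    rw [Finset.sum_comm]
    refine Finset.sum_congr rfl fun d _ => ?_
    rw [Finset.mul_sum]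
  -- (f) the autocorrelations vanish: `Σ_k (Lu(k+d) Lu(k) + Lv(k+d) Lv(k)) = E₁(d) + E₂(d) η = 0`
  set q : ℕ := (p + 1) / 4 with hq_def
  have hterm : ∀ a₁ b₁ a₂ b₂ : ℂ, (a₁ + b₁ * η) * (a₂ + b₂ * η) =
      (a₁ * a₂ - (q : ℂ) * (b₁ * b₂)) + (a₁ * b₂ + a₂ * b₁ - b₁ * b₂) * η := by
    intro a₁ b₁ a₂ b₂
    linear_combination (b₁ * b₂) * hη2
  have hE₁' : ∀ d : ZMod (2 * m), ∑ k : ZMod (2 * m), (((αu (k + d) : ℂ) * αu k - (q : ℂ) * ((βu (k + d) : ℂ) * βu k)) +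
      ((αv (k + d) : ℂ) * αv k - (q : ℂ) * ((βv (k + d) : ℂ) * βv k))) = 0 := fun d => by
    have h := hE₁ d
    simp only [hαu, hβu, hαv, hβv]
    exact_mod_cast h
  have hE₂' : ∀ d : ZMod (2 * m), ∑ k : ZMod (2 * m), (((αu (k + d) : ℂ) * βu k + (αu k : ℂ) * βu (k + d) - (βu (k + d) : ℂ) * βu k) +
      ((αv (k + d) : ℂ) * βv k + (αv k : ℂ) * βv (k + d) - (βv (k + d) : ℂ) * βv k)) = 0 := fun d => by
    have h := hE₂ d
    simp only [hαu, hβu, hαv, hβv]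
    exact_mod_cast h
  have hE : ∀ d : ZMod (2 * m), ∑ k : ZMod (2 * m), (Lu (k + d) * Lu k + Lv (k + d) * Lv k) = 0 := by
    intro d
    calc ∑ k : ZMod (2 * m), (Lu (k + d) * Lu k + Lv (k + d) * Lv k)
        = ∑ k : ZMod (2 * m), ((((αu (k + d) : ℂ) * αu k - (q : ℂ) * ((βu (k + d) : ℂ) * βu k)) +
            ((αv (k + d) : ℂ) * αv k - (q : ℂ) * ((βv (k + d) : ℂ) * βv k))) +
          ((((αu (k + d) : ℂ) * βu k + (αu k : ℂ) * βu (k + d) - (βu (k + d) : ℂ) * βu k) +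
            ((αv (k + d) : ℂ) * βv k + (αv k : ℂ) * βv (k + d) - (βv (k + d) : ℂ) * βv k))) * η) := by
          refine Finset.sum_congr rfl fun k _ => ?_
          simp only [hLu, hLv]
          rw [hterm, hterm]; ring
      _ = 0 := by rw [Finset.sum_add_distrib, ← Finset.sum_mul, hE₁' d, hE₂' d]; ring
  -- (g) the two-sheet block of `T₁` at `χ₀` is singular
  have hΔ : (∑ s ∈ S₁, χ₀ (Additive.ofMul s)) * (∑ s ∈ S₁, χ₀ (Additive.ofMul (θ s))) -
      χ₀ (Additive.ofMul c) * ((∑ t ∈ S₂, χ₀ (Additive.ofMul t)) * (∑ t ∈ S₂, χ₀ (Additive.ofMul (θ t)))) = 0 := by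
    rw [eS₁, eS₁θ, eS₂, eS₂θ, hχc, hprod Lu, mul_comm (∑ j : ZMod (2 * m), ψ₂ (-j) * Lv j), hprod Lv]
    rw [show ∀ x y : ℂ, x - (-1) * y = x + y from fun x y => by ring, ← Finset.sum_add_distrib]
    refine Finset.sum_eq_zero fun d _ => ?_
    rw [← mul_add, ← Finset.sum_add_distrib, hE d, mul_zero]
  -- (h) the balanced annihilator
  obtain ⟨b, hb0, hanti, hann, hbal⟩ := TwoSheet.exists_annihilator_of_det_eq_zero_balanced i hi (xa 0, 1) hx hcov θ hθ c hxx
    hθc T₁ S₁ S₂ hS₁ hS₂ χ₀ hχc hΔ N hN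
  refine ⟨b, Function.ne_iff.mp hb0, fun g => ?_, hann, fun g => ?_⟩
  · rw [← hic]; exact hanti g
  · have h := hbal g
    rw [hNsumQ] at h
    simpa only [hi_apply, toAdd_one, ← one_def] using h
end Summit.HodgeConjecture.CorCM.GaloisQuaternionCyclic

end
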